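import Literature.MathematicalPhysics.QuantumFieldTheory.Balaban1983to89.Node00.Carriers3
import Literature.MathematicalPhysics.QuantumFieldTheory.Balaban1983to89.Node00.WorldFrame
import Literature.MathematicalPhysics.QuantumFieldTheory.Balaban1983to89.Node00.Satisfiable
import Literature.MathematicalPhysics.QuantumFieldTheory.Balaban1983to89.B14Cor3

/-!
# YM-DAG node N13 · [Balaban1989LargeFieldII] (CMP **122** (1989) 355) — Theorem 1 p. 355 + (0.1), Cor. 3 pp. 387 ∕ 391 — KNIT BY NAME:
# `Dag.B16_main (DagBinding.leavesP w P)` at a run bound to the N-binding, its two OWN products as displayed slots, the Cor.-3 slot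
# reduced to [III] p. 264's typed derivation (`B14Cor3`), and the kernel census of what NODE 00 Stage 3 does NOT decide about N13

TRACK-A SEAT FILE (seat `pub-ymgap-dag-n13-a`, KNIT-BY-NAME for node N13 of YM-PLAN §2b; statement of record = the predicate
`YMDAG.N13 w P := Dag.B16_main (DagBinding.leavesP w P)` of the venue `HOME/lean/ym-dag/N13_B16.lean`).  THEOREMS ONLY, no definition;
kernel bookkeeping over LANDED modules referenced BY NAME (`Dag`, `DagBinding`, `DagDischargedII`, `Node00.Carriers…Carriers3`,
`Node00.WorldFrame`, `Node00.Satisfiable`, `B14Cor3`, `B16`).  Companion of `Node00.CarriersFrame` §3 (which unfolds the eight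
carrier-only nodes at a run) and of `Node00.WorldFrame` §2–§3 (which unfolds N09 ∕ N11 ∕ N13 at an ARBITRARY world): this file adds,
for N13, (i) the unfolding AT A RUN BOUND TO THE N-BINDING `Upstream.ofPrintedAllXPN X Y Z V W` — so that the node's first product is
the printed p. 244 [III] assumption `DagBinding.ROpLeaf V` of the run's 𝐑-carriers `V` BY NAME — in a stage-agnostic form and in the
Stage-3 form (pinned antecedents `b5`, `b7` discharged by `Node00.carriers₁_b5` ∕ `carriers₂_b7`); (ii) the DISCHARGE-SHAPED theorem:
N13 at a run from its two OWN products as displayed named slots — the R-slot `ROpLeaf V` (what [Balaban1989LargeFieldII] Thm 1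
delivers for [III]'s assumed 𝐑: *"the result 𝐑ρ_k of the 𝐑-operation can be written in the form (2.18) [III], with all the expressions
satisfying the induction hypothesis described in Sect. 2 [III]"*, p. 391) and the Cor.-3 slot ((2.50) [III] ∕ (0.1) at the world's
construction `w.C`, threshold `w.γ` and exponent functions `w.em, w.ep`, GIVEN the §2 description — p. 387: *"This implies the
inequality (2.50) [III], hence Corollary 3."*); over an explicitly PINNED 𝐑-carrier family `V₀` at world level (R422 shape: never closed
over the unpinned Stage-3 frame); (iii) the Cor.-3 slot derived BY NAME from the typed p. 264 [III] derivation `B14Cor3.uvIneq_of_termData`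
((2.18) representation + leaves U1 U2 L1 L2), which CONSUMES the node's `densitiesDescribed` antecedent through the `Sect2Form k` guard
of every `B14Cor3` leaf; (iv) the interface a Stage-5 record predicate must supply for N13, as one implication over an arbitrary world
predicate; (v) KERNEL CENSUS: `Node00.IsWorldOfRecord₃` is satisfiable (not yet on file), the R-slot takes BOTH truth values across Stage-3
worlds of record (the 𝐑-carriers `V` are existential there), hence there is a Stage-3 world of record at which N13's CONCLUSION fails at
every run (N13 can hold there only by the failure of an in-edge antecedent — the vacuity guard's ex-falso case) and one at which N13 HOLDS at
every run: N13 is independent of Stage 3 and needs the Stage-5 pin of `V` and `C` (per-node form of `not_paperClusters_over_stage2Frame`).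
HONEST FRAMING: nothing of Bałaban's is asserted or proved here; N13 is NOT discharged (C-bound: its products live on the construction and
the 𝐑-carriers of record, NODE 00 Stage 5); the census witnesses are DEGENERATE carriers inside proofs, never offered as objects of record;
one finite T⁴ programme at fixed ε ([Balaban1989LargeFieldII] Thm 1 scope); NOT ℝ⁴, NOT infinite volume, NOT OS axioms, NOT mass gap, NOT Clay.
-/

noncomputable section

namespace Literature.MathematicalPhysics.QuantumFieldTheory.Balaban1983to89.B16NodeKnit

open DagBinding DagDischargedII Node00

/-! ## §1. N13's first product at the N-binding is [III] p. 244's assumed 𝐑 for the run's carriers, by name -/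

section Run

variable {w : WorldP} {P : B12.RunParams} {X : PrintedCarriersR} {Y : PrintedCarriers9X} {Z : PrintedCarriers11}
  {V : PrintedCarriers14R} {W : PrintedCarriers15}

/-- **The `rOperation` leaf of a run bound to the N-binding IS `ROpLeaf V`** — [Balaban1988Convergent] p. 244, verbatim: *"The operation 𝐑
serves this purpose. We will not describe it here, we will only assume that it has some properties incorporated in the inductive description
of the effective actions."* — for the run's 𝐑-carriers `V` (`DagDischargedII.ofPrintedAllXPN_leaves`, definitional).
[cite: Balaban1988Convergent, p.244 (the assumed 𝐑; bookkeeping)] -/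
theorem rOperation_iff_rOpLeaf (hP : w.up P = Upstream.ofPrintedAllXPN X Y Z V W) :
    (leavesP w P).rOperation ↔ ROpLeaf V := by
  show (w.up P).rOperation ↔ _
  rw [hP]
  exact Iff.rfl

/-- The same leaf unfolded to the printed clause: `∀ k < K, ∀ ρ′` with the «corresponding assumptions» `Scorr (k+1) ρ′`, the density
`𝐑_k ρ′` satisfies the Sect. 2 assumptions `S (k+1)` (`DagBinding.rOpLeaf_iff`). [cite: Balaban1988Convergent, p.244 and remark p.262 («𝐑T transforms the space with the index k into the space with the index k+1»; bookkeeping)] -/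
theorem rOperation_iff_rAssumed (hP : w.up P = Upstream.ofPrintedAllXPN X Y Z V W) :
    (leavesP w P).rOperation ↔
      ∀ k, k < V.K → ∀ ρ' : Density V.P (k + 1) V.G, V.Scorr (k + 1) ρ' → V.S (k + 1) (V.R k ρ') :=
  (rOperation_iff_rOpLeaf hP).trans (rOpLeaf_iff V)

/-! ## §2. N13 at a run bound to the N-binding, unfolded to its printed leaves -/

/-- **N13 at a run bound to `Upstream.ofPrintedAllXPN X Y Z V W`, UNFOLDED** (stage-agnostic): the in-edge leaves are the printed statements
of [B5] [B6] [B7] [B9] [B10] [B11] [B13] [B15] over the run's carriers `X Y Z W` and the world leaf «interval ⇒ inductive assumptions» of `w.C P`;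
the products are `ROpLeaf V` and «(interval ⇒ §2 description) ⇒ (interval ⇒ (2.50) with `e±(g_k)`)» for `w.C P`.  Definitional (`rw` +
`Iff.rfl`). [cite: Balaban1989LargeFieldII, Thm 1 and (0.1) p.355; Balaban1988Convergent, Cor. 3 (2.50) p.264 (dictionary, bookkeeping)] -/
theorem b16_main_iff_of_up (hP : w.up P = Upstream.ofPrintedAllXPN X Y Z V W) :
    Dag.B16_main (leavesP w P) ↔
      ((Upstream.ofPrintedAllXPN X Y Z V W).b5 → B6BlockParam X.D6 → (Upstream.ofPrintedAllXPN X Y Z V W).b7 → B9LeafX Y →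
        (B10.Thm1Printed X.runs10 ∧ B10.Thm2Printed X.runs10) → B11Leaf Z →
          (B13.Lemma1Printed X.S13 X.c13 ∧ B13.Lemma2Printed X.S13 X.c13 ∧ B13.Lemma3Printed X.S13 X.c13) → B15Leaf W →
            ((w.C P).flow.InInterval w.γ P.K → ∀ k, k ≤ P.K → (w.C P).IndAss k) →
              (ROpLeaf V ∧
                (((w.C P).flow.InInterval w.γ P.K → ∀ k, k ≤ P.K → (w.C P).Sect2Form k) →
                  ((w.C P).flow.InInterval w.γ P.K → ∀ k, k ≤ P.K → ∀ U : (w.C P).Cfg k,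
                    B16.UVIneq (w.C P) k U (w.em ((w.C P).flow.g k)) (w.ep ((w.C P).flow.g k)))))) := by
  show ((w.up P).b5 → (w.up P).b6 → (w.up P).b7 → (w.up P).b9 → (w.up P).b10 → (w.up P).b11 → (w.up P).b13 →
    (w.up P).rBasicStep → _ → ((w.up P).rOperation ∧ _)) ↔ _
  rw [hP]
  exact Iff.rfl

/-- **The DISCHARGE-SHAPED theorem at a run**: N13 holds at a run bound to the N-binding as soon as its two OWN products hold there — the
R-slot `ROpLeaf V` ([Balaban1989LargeFieldII] Thm 1's delivery of [III] p. 244's assumed 𝐑, p. 391: *"the result 𝐑ρ_k of the 𝐑-operation can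
be written in the form (2.18) [III], with all the expressions satisfying the induction hypothesis described in Sect. 2 [III]. This completes the
proof of Theorem 1 and Corollary 3."*) and the Cor.-3 slot at `w.C P` (p. 387: *"This implies the inequality (2.50) [III], hence Corollary 3."*,
GIVEN the §2 description).  The nine in-edge antecedents are not used (the products are asserted outright, as N04's `b7`); both slots are
HYPOTHESES — nothing of the paper is proved here. [cite: Balaban1989LargeFieldII, Thm 1 p.355, p.387, p.391] -/
theorem b16_main_of_rOp_of_uv (hP : w.up P = Upstream.ofPrintedAllXPN X Y Z V W) (hR : ROpLeaf V)
    (huv : ((w.C P).flow.InInterval w.γ P.K → ∀ k, k ≤ P.K → (w.C P).Sect2Form k) →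
      (w.C P).flow.InInterval w.γ P.K → ∀ k, k ≤ P.K → ∀ U : (w.C P).Cfg k,
        B16.UVIneq (w.C P) k U (w.em ((w.C P).flow.g k)) (w.ep ((w.C P).flow.g k))) :
    Dag.B16_main (leavesP w P) :=
  (b16_main_iff_of_up hP).2 fun _ _ _ _ _ _ _ _ _ => ⟨hR, huv⟩

/-- Conversely N13 at such a run, together with its in-edge leaves, GIVES the R-slot: the node's first product is exactly [III] p. 244's
assumption for the run's 𝐑-carriers (so a proof of N13 that does not refute an in-edge proves `ROpLeaf V`). [cite: Balaban1988Convergent, p.244; Balaban1989LargeFieldII, Thm 1 p.355 (bookkeeping)] -/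
theorem rOpLeaf_of_b16_main (hP : w.up P = Upstream.ofPrintedAllXPN X Y Z V W) (h : Dag.B16_main (leavesP w P))
    (h5 : (w.up P).b5) (h6 : (w.up P).b6) (h7 : (w.up P).b7) (h9 : (w.up P).b9) (h10 : (w.up P).b10) (h11 : (w.up P).b11)
    (h13 : (w.up P).b13) (h15 : (w.up P).rBasicStep)
    (hsf : (w.C P).flow.InInterval w.γ P.K → ∀ k, k ≤ P.K → (w.C P).IndAss k) : ROpLeaf V :=
  (rOperation_iff_rOpLeaf hP).1 (h h5 h6 h7 h9 h10 h11 h13 h15 hsf).1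

end Run

/-! ## §3. The Stage-3 form: pinned antecedents discharged, the block of record displayed -/

section Stage3

variable {w : WorldP} {P : B12.RunParams} (θ : Stage3Params) {X : PrintedCarriersR} {Y : PrintedCarriers9X}
  {Z : PrintedCarriers11} {V : PrintedCarriers14R} {W : PrintedCarriers15}

/-- **N13 at a run of a Stage-3 world of record, UNFOLDED** (`w.up P = ofPrintedAllXPN (carriers₃ θ X) Y Z V W`, admissible `θ`): the
antecedents `b5` ([Balaban1984PropagatorsI], `Node00.carriers₁_b5`) and `b7` ([Balaban1985Averaging], `Node00.carriers₂_b7`) HOLD at the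
objects of record and drop out; `b6` is the parameter-form block of the k-level block OF RECORD `Node00.D6OfRecord θ`; the groups B10 ∕ B13
of `X` and the bundles `Y Z V W` are the run's FREE carriers (Stage 3 does not pin them), and the products read `V` and `w.C P`.
[cite: Balaban1989LargeFieldII, Thm 1 and (0.1) p.355; Balaban1984PropagatorsII, Lemma 2.1 – Cor. 2.8 pp.234–249 (the block of record; dictionary, bookkeeping)] -/
theorem b16_main_iff_of_up₃ (hθ : θ.toStage1Params.Admissible)
    (hP : w.up P = Upstream.ofPrintedAllXPN (carriers₃ θ X) Y Z V W) :
    Dag.B16_main (leavesP w P) ↔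
      (B6BlockParam (D6OfRecord θ) → B9LeafX Y → (B10.Thm1Printed X.runs10 ∧ B10.Thm2Printed X.runs10) → B11Leaf Z →
        (B13.Lemma1Printed X.S13 X.c13 ∧ B13.Lemma2Printed X.S13 X.c13 ∧ B13.Lemma3Printed X.S13 X.c13) → B15Leaf W →
          ((w.C P).flow.InInterval w.γ P.K → ∀ k, k ≤ P.K → (w.C P).IndAss k) →
            (ROpLeaf V ∧
              (((w.C P).flow.InInterval w.γ P.K → ∀ k, k ≤ P.K → (w.C P).Sect2Form k) →
                ((w.C P).flow.InInterval w.γ P.K → ∀ k, k ≤ P.K → ∀ U : (w.C P).Cfg k,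
                  B16.UVIneq (w.C P) k U (w.em ((w.C P).flow.g k)) (w.ep ((w.C P).flow.g k)))))) := by
  have h5 : (Upstream.ofPrintedAllXPN (carriers₃ θ X) Y Z V W).b5 :=
    carriers₁_b5 θ.toStage1Params hθ (withB7OfRecord (withB6KOfRecord X θ) θ.D θ.L θ.𝔸) Y Z V W
  have h7 : (Upstream.ofPrintedAllXPN (carriers₃ θ X) Y Z V W).b7 := carriers₂_b7 θ.toStage2Params (withB6KOfRecord X θ) Y Z V W
  rw [b16_main_iff_of_up hP]
  exact ⟨fun h h6 h9 h10 h11 h13 h15 hsf => h h5 h6 h7 h9 h10 h11 h13 h15 hsf,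
    fun h _ h6 _ h9 h10 h11 h13 h15 hsf => h h6 h9 h10 h11 h13 h15 hsf⟩

/-- **N13 at every run of a Stage-3 world of record MODULO ITS TWO PRODUCT SLOTS, with the 𝐑-carriers PINNED** (R422 shape): if at every run the
upstream block is the N-binding over `carriers₃ θ X` with 𝐑-carriers `V₀ P` (an explicit family — the future 𝐑-carriers of record), the R-slot
holds for `V₀ P` and the Cor.-3 slot holds for `w.C P`, then `Dag.B16_main (leavesP w P)` for every `P`.  The displayed hypotheses are what
[Balaban1989LargeFieldII] proves (Thm 1 for 𝐑, pp. 356–391; Cor. 3, p. 387) — HYPOTHESES here. [cite: Balaban1989LargeFieldII, Thm 1 p.355, p.387, p.391] -/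
theorem b16_main_of_pinnedR₃ (V₀ : B12.RunParams → PrintedCarriers14R)
    (hpin : ∀ P : B12.RunParams, ∃ (X : PrintedCarriersR) (Y : PrintedCarriers9X) (Z : PrintedCarriers11) (W : PrintedCarriers15),
      w.up P = Upstream.ofPrintedAllXPN (carriers₃ θ X) Y Z (V₀ P) W)
    (hR : ∀ P : B12.RunParams, ROpLeaf (V₀ P))
    (huv : ∀ P : B12.RunParams, ((w.C P).flow.InInterval w.γ P.K → ∀ k, k ≤ P.K → (w.C P).Sect2Form k) →
      (w.C P).flow.InInterval w.γ P.K → ∀ k, k ≤ P.K → ∀ U : (w.C P).Cfg k,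
        B16.UVIneq (w.C P) k U (w.em ((w.C P).flow.g k)) (w.ep ((w.C P).flow.g k)))
    (P : B12.RunParams) : Dag.B16_main (leavesP w P) := by
  obtain ⟨X, Y, Z, W, hP⟩ := hpin P
  exact b16_main_of_rOp_of_uv hP (hR P) (huv P)

/-- Such a world IS a Stage-3 world of record (the pin refines `Node00.IsWorldOfRecord₃`; witness `V := V₀ P`). [cite: Balaban1984PropagatorsII, pp.223–250 (objects of record, Stage 3; bookkeeping)] -/
theorem isWorldOfRecord₃_of_pinnedR (hθ : θ.toStage1Params.Admissible) (V₀ : B12.RunParams → PrintedCarriers14R)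
    (hpin : ∀ P : B12.RunParams, ∃ (X : PrintedCarriersR) (Y : PrintedCarriers9X) (Z : PrintedCarriers11) (W : PrintedCarriers15),
      w.up P = Upstream.ofPrintedAllXPN (carriers₃ θ X) Y Z (V₀ P) W) :
    IsWorldOfRecord₃ w := by
  refine ⟨θ, hθ, fun P => ?_⟩
  obtain ⟨X, Y, Z, W, hP⟩ := hpin P
  exact ⟨X, Y, Z, V₀ P, W, hP⟩

end Stage3

/-! ## §4. The Cor.-3 slot BY NAME from [III] p. 264's typed derivation (`B14Cor3`), consuming the `densitiesDescribed` antecedent -/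

section Cor3

variable (w : WorldP)

/-- **N13's second product from the (2.18)-representation interface of [Balaban1988Convergent] p. 264** (typed derivation
`B14Cor3.uvIneq_of_termData`): given, for the run `P` and every step `k`, representation data `R k` (admissible sequences, summands,
majorants, the all-small sequence) such that UNDER the interval hypothesis and GIVEN the §2 description `Sect2Form k` — exactly the guard under
which Cor. 3 is printed (*"Under the assumptions of Theorem 1"*) — (H) the representation holds, (U1) summands ≤ majorants, (U2) Σ majorants ≤
`exp(e₊(g_k)|T_η|)`, (L1) summands ≥ 0, (L2) the all-small summand ≥ `χ_k exp[−A∕g_k² − e₋(g_k)|T_η|]`, the node's implication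
«(interval ⇒ §2 description) ⇒ (interval ⇒ (2.50) with `w.em, w.ep`)» holds at `P`.  The antecedent `densitiesDescribed` is USED: it feeds the
`Sect2Form k` guard of every leaf.  The five leaves are the located inputs of cell GAPS G-adv3-1 ∕ G-adv3-2 — HYPOTHESES. [cite: Balaban1988Convergent, Cor. 3 (2.50) p.264; Balaban1989LargeFieldII, p.387] -/
theorem uvSlot_of_termData (P : B12.RunParams) (R : (k : ℕ) → B14Cor3.TermData (w.C P) k)
    (hH : (w.C P).flow.InInterval w.γ P.K → ∀ k, k ≤ P.K → (w.C P).Sect2Form k → (R k).Holds)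
    (hU1 : (w.C P).flow.InInterval w.γ P.K → ∀ k, k ≤ P.K → (w.C P).Sect2Form k →
      ∀ a (U : (w.C P).Cfg k), (R k).term a U ≤ (R k).major a)
    (hU2 : (w.C P).flow.InInterval w.γ P.K → ∀ k, k ≤ P.K → (w.C P).Sect2Form k →
      ∑ a, (R k).major a ≤ Real.exp (w.ep ((w.C P).flow.g k) * ((w.C P).numSites k : ℝ)))
    (hL1 : (w.C P).flow.InInterval w.γ P.K → ∀ k, k ≤ P.K → (w.C P).Sect2Form k →
      ∀ a (U : (w.C P).Cfg k), 0 ≤ (R k).term a U)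
    (hL2 : (w.C P).flow.InInterval w.γ P.K → ∀ k, k ≤ P.K → (w.C P).Sect2Form k → ∀ U : (w.C P).Cfg k,
      (w.C P).χ k U * Real.exp (-(1 / ((w.C P).flow.g k) ^ 2 * (w.C P).wilsonBG k U)
          - w.em ((w.C P).flow.g k) * ((w.C P).numSites k : ℝ)) ≤ (R k).term (R k).allSmall U) :
    ((leavesP w P).smallCouplings → (leavesP w P).densitiesDescribed) →
      ((leavesP w P).smallCouplings → (leavesP w P).uvBounds) := by
  intro hdd hsc k hk U
  have hs : (w.C P).Sect2Form k := hdd hsc k hk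
  exact B14Cor3.uvIneq_of_termData (w.C P) k (R k) _ _ (hH hsc k hk hs) (hU1 hsc k hk hs) (hU2 hsc k hk hs)
    (hL1 hsc k hk hs) (hL2 hsc k hk hs) U

/-- **World level**: the five `B14Cor3` leaves `LeafH ∕ LeafU1 ∕ LeafU2 ∕ LeafL1 ∕ LeafL2` of the world's construction `w.C`, over a representation
family `R`, on the world's interval `]0, w.γ]`, with the world's exponent functions `w.ep ∕ w.em`, give N13's second product at EVERY run.
[cite: Balaban1988Convergent, Cor. 3 (2.50) p.264 («Under the assumptions of Theorem 1 there exist constants E₋, E₊ … depending on g_k»)] -/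
theorem uvSlot_of_cor3Leaves (R : B14Cor3.ReprFamily w.C) (hH : B14Cor3.LeafH w.C R w.γ) (hU1 : B14Cor3.LeafU1 w.C R w.γ)
    (hU2 : B14Cor3.LeafU2 w.C R w.γ w.ep) (hL1 : B14Cor3.LeafL1 w.C R w.γ) (hL2 : B14Cor3.LeafL2 w.C R w.γ w.em)
    (P : B12.RunParams) :
    ((leavesP w P).smallCouplings → (leavesP w P).densitiesDescribed) →
      ((leavesP w P).smallCouplings → (leavesP w P).uvBounds) :=
  uvSlot_of_termData w P (R P) (hH P) (hU1 P) (hU2 P) (hL1 P) (hL2 P)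

/-- **N13 at every run from the pinned R-slot and the five Cor.-3 leaves** (the knit of record of this file): 𝐑-carriers pinned to `V₀`, [III]
p. 244's property for them (`ROpLeaf (V₀ P)` — [Balaban1989LargeFieldII] Thm 1's delivery), and [III] p. 264's five representation leaves at
`(w.C, w.γ, w.em, w.ep)`.  Every displayed hypothesis is a located printed ∕ reader's input, none is proved here.
[cite: Balaban1989LargeFieldII, Thm 1 p.355, p.387, p.391; Balaban1988Convergent, p.244, Cor. 3 p.264] -/
theorem b16_main_of_pinnedR_of_cor3Leaves (V₀ : B12.RunParams → PrintedCarriers14R)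
    (hpin : ∀ P : B12.RunParams, ∃ (X : PrintedCarriersR) (Y : PrintedCarriers9X) (Z : PrintedCarriers11) (W : PrintedCarriers15),
      w.up P = Upstream.ofPrintedAllXPN X Y Z (V₀ P) W)
    (hR : ∀ P : B12.RunParams, ROpLeaf (V₀ P))
    (R : B14Cor3.ReprFamily w.C) (hH : B14Cor3.LeafH w.C R w.γ) (hU1 : B14Cor3.LeafU1 w.C R w.γ)
    (hU2 : B14Cor3.LeafU2 w.C R w.γ w.ep) (hL1 : B14Cor3.LeafL1 w.C R w.γ) (hL2 : B14Cor3.LeafL2 w.C R w.γ w.em)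
    (P : B12.RunParams) : Dag.B16_main (leavesP w P) := by
  obtain ⟨X, Y, Z, W, hP⟩ := hpin P
  exact b16_main_of_rOp_of_uv hP (hR P) (uvSlot_of_cor3Leaves w R hH hU1 hU2 hL1 hL2 P)

end Cor3

/-! ## §5. What a record predicate must supply for N13 (the `S_N13 Rec` shape over an arbitrary world predicate) -/

/-- **The N13 pin list, kernel form.**  For ANY predicate `IsRec` on binding worlds (e.g. NODE 00's Stage-5 record predicate restricted to
worlds): if every `IsRec`-world comes with a pinned 𝐑-carrier family `V₀` bound at every run, [III] p. 244's property of `V₀ P`, and the five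
[III] p. 264 leaves of its construction on its own interval with its own exponent functions, then N13 holds at every run of every
`IsRec`-world — the shape `∀ w, Rec w → ∀ P, Dag.B16_main (leavesP w P)` of the dagwriter's stub `S_N13`.  Pure logic over §4.
[cite: Balaban1989LargeFieldII, Thm 1 p.355 + p.391 (bookkeeping of what the node needs from the objects of record)] -/
theorem atRecord_b16_main_of {IsRec : WorldP → Prop}
    (hst : ∀ w : WorldP, IsRec w →
      ∃ (V₀ : B12.RunParams → PrintedCarriers14R) (R : B14Cor3.ReprFamily w.C),
        (∀ P : B12.RunParams, ∃ (X : PrintedCarriersR) (Y : PrintedCarriers9X) (Z : PrintedCarriers11) (W : PrintedCarriers15),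
          w.up P = Upstream.ofPrintedAllXPN X Y Z (V₀ P) W) ∧
        (∀ P : B12.RunParams, ROpLeaf (V₀ P)) ∧
        B14Cor3.LeafH w.C R w.γ ∧ B14Cor3.LeafU1 w.C R w.γ ∧ B14Cor3.LeafU2 w.C R w.γ w.ep ∧
        B14Cor3.LeafL1 w.C R w.γ ∧ B14Cor3.LeafL2 w.C R w.γ w.em) :
    ∀ w : WorldP, IsRec w → ∀ P : B12.RunParams, Dag.B16_main (leavesP w P) := by
  intro w hw P
  obtain ⟨V₀, R, hpin, hR, hH, hU1, hU2, hL1, hL2⟩ := hst w hw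
  exact b16_main_of_pinnedR_of_cor3Leaves w V₀ hpin hR R hH hU1 hU2 hL1 hL2 P

/-! ## §6. Kernel census: Stage 3 does not decide N13 (the 𝐑-carriers and the construction are not pinned there) -/

/-- Stage-3 family parameters with admissible Stage-1 part and physical dimension 4 EXIST (from `Node00.Stage1Params.exists_admissible`:
`𝔸 := ℂ`, `d₆ := 3`, `ℓ₆ := L − 1`, band `b₀ = b₁ = 1`, rate `δ₀ := 2∕L`). [cite: Balaban1984PropagatorsII, (2.1)–(2.4) p.224, (2.16) p.225, (2.59) p.233 (parameter dictionary; bookkeeping)] -/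
theorem exists_stage3Params_admissible : ∃ θ : Stage3Params, θ.toStage1Params.Admissible ∧ θ.D = 4 := by
  obtain ⟨θ, hθ, hD⟩ := Stage1Params.exists_admissible
  have hL : 1 < θ.L := θ.hL.2
  have hd₆ : 3 + 1 = θ.D := by omega
  have hℓ₆ : θ.L - 1 + 1 = θ.L := by omega
  have hpos : (0 : ℝ) < ((θ.L - 1 : ℕ) : ℝ) + 1 := by positivity
  have hb : (0 : ℝ) < 1 ∧ (1 : ℝ) ≤ 1 := ⟨one_pos, le_rfl⟩
  have hδ₀ : 0 < 2 / (((θ.L - 1 : ℕ) : ℝ) + 1) ∧ 2 / (((θ.L - 1 : ℕ) : ℝ) + 1) ≤ 2 / (((θ.L - 1 : ℕ) : ℝ) + 1) :=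
    ⟨div_pos two_pos hpos, le_rfl⟩
  let θ₂ : Stage2Params := { θ with 𝔸 := ℂ }
  exact ⟨Stage3Params.mk θ₂ 3 (θ.L - 1) hd₆ hℓ₆ 1 1 hb (2 / (((θ.L - 1 : ℕ) : ℝ) + 1)) hδ₀, hθ, hD⟩

/-- **`Node00.IsWorldOfRecord₃` is satisfiable** (type-level sanity for every «at every Stage-3 world of record» theorem; the un-pinned bundles of
the witness are the DEGENERATE ones of `Node00.Satisfiable`, not objects of record). [cite: Balaban1984PropagatorsII, pp.223–250 (objects of record, Stage 3; bookkeeping)] -/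
theorem exists_isWorldOfRecord₃ : ∃ w : WorldP, IsWorldOfRecord₃ w := by
  obtain ⟨θ, hθ, -⟩ := exists_stage3Params_admissible
  obtain ⟨X⟩ := nonempty_printedCarriersR; obtain ⟨Y⟩ := nonempty_printedCarriers9X
  obtain ⟨Z⟩ := nonempty_printedCarriers11; obtain ⟨V⟩ := nonempty_printedCarriers14R; obtain ⟨W⟩ := nonempty_printedCarriers15
  obtain ⟨w⟩ := nonempty_worldP
  exact ⟨WorldP.withUp w fun _ => Upstream.ofPrintedAllXPN (carriers₃ θ X) Y Z V W, isWorldOfRecord₃_of_up θ hθ X Y Z V W _ rfl⟩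

/-- **Stage 3 does not constrain the 𝐑-carriers**: for EVERY `V : PrintedCarriers14R` and every binding world `w₀` there is a Stage-3 world of
record with the same construction, threshold and exponent functions as `w₀` whose `rOperation` leaf at every run is `ROpLeaf V`.
[cite: Balaban1988Convergent, p.244 (the assumed 𝐑 is a statement about carriers NODE 00 has not pinned at Stage 3; bookkeeping)] -/
theorem exists_isWorldOfRecord₃_rOperation_iff (V : PrintedCarriers14R) (w₀ : WorldP) :
    ∃ w : WorldP, IsWorldOfRecord₃ w ∧ w.C = w₀.C ∧ w.γ = w₀.γ ∧ w.em = w₀.em ∧ w.ep = w₀.ep ∧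
      ∀ P : B12.RunParams, (leavesP w P).rOperation ↔ ROpLeaf V := by
  obtain ⟨θ, hθ, -⟩ := exists_stage3Params_admissible
  obtain ⟨X⟩ := nonempty_printedCarriersR; obtain ⟨Y⟩ := nonempty_printedCarriers9X
  obtain ⟨Z⟩ := nonempty_printedCarriers11; obtain ⟨W⟩ := nonempty_printedCarriers15
  refine ⟨WorldP.withUp w₀ fun _ => Upstream.ofPrintedAllXPN (carriers₃ θ X) Y Z V W,
    isWorldOfRecord₃_of_up θ hθ X Y Z V W _ rfl, rfl, rfl, rfl, rfl, fun P => ?_⟩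
  exact rOperation_iff_rOpLeaf (w := WorldP.withUp w₀ fun _ => Upstream.ofPrintedAllXPN (carriers₃ θ X) Y Z V W) rfl

/-- **The R-slot is not a tautology**: some 𝐑-carrier bundle VIOLATES [III] p. 244's property (DEGENERATE witness: one step, `Scorr := True`,
`S := False`, the identity as 𝐑 — nothing to do with Bałaban's 𝐑). [cite: Balaban1988Convergent, p.244 (bookkeeping: the assumption has content)] -/
theorem exists_not_rOpLeaf : ∃ V : PrintedCarriers14R, ¬ ROpLeaf V := by
  obtain ⟨P₀⟩ := nonempty_params
  refine ⟨{ P := P₀, G := ↥(Matrix.unitaryGroup (Fin 1) ℂ), instGG := inferInstance, instMS := inferInstance, instHD := inferInstance,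
            K := 1, R := fun _ ρ => ρ, Scorr := fun _ _ => True, S := fun _ _ => False }, fun h => ?_⟩
  exact h 0 zero_lt_one (fun _ => 0) trivial

/-- … and some bundle SATISFIES it (DEGENERATE: `S := True`). [cite: Balaban1988Convergent, p.244 (bookkeeping: the slot is satisfiable)] -/
theorem exists_rOpLeaf : ∃ V : PrintedCarriers14R, ROpLeaf V := by
  obtain ⟨P₀⟩ := nonempty_params
  exact ⟨{ P := P₀, G := ↥(Matrix.unitaryGroup (Fin 1) ℂ), instGG := inferInstance, instMS := inferInstance, instHD := inferInstance,
           K := 1, R := fun _ ρ => ρ, Scorr := fun _ _ => True, S := fun _ _ => True }, fun _ _ _ _ => trivial⟩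

/-- **There is a Stage-3 world of record at which N13's CONCLUSION FAILS at every run** (its R-slot is false there).  Hence at that world
`Dag.B16_main (leavesP w P)` can hold at a run only because one of its nine in-edge antecedents fails — the ex-falso case the vacuity guard
(YM-PLAN §1) excludes from any booking; a Stage-3 «discharge» of N13 is therefore impossible without refuting an in-edge: the 𝐑-carriers must be
PINNED first (R422; NODE 00 Stage 5). [cite: Balaban1989LargeFieldII, Thm 1 p.355 (bookkeeping: what Stage 3 leaves open for N13)] -/
theorem exists_isWorldOfRecord₃_not_conclusion :
    ∃ w : WorldP, IsWorldOfRecord₃ w ∧ ∀ P : B12.RunParams,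
      ¬ ((leavesP w P).rOperation ∧
          (((leavesP w P).smallCouplings → (leavesP w P).densitiesDescribed) →
            ((leavesP w P).smallCouplings → (leavesP w P).uvBounds))) := by
  obtain ⟨V, hV⟩ := exists_not_rOpLeaf
  obtain ⟨w₀⟩ := nonempty_worldP
  obtain ⟨w, hw, -, -, -, -, hiff⟩ := exists_isWorldOfRecord₃_rOperation_iff V w₀
  exact ⟨w, hw, fun P h => hV ((hiff P).1 h.1)⟩

/-- At that world, spelled out: N13 at a run IMPLIES that its in-edge antecedents do not all hold (contrapositive of the node's shape).
[cite: Balaban1989LargeFieldII, Thm 1 p.355 (bookkeeping)] -/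
theorem exists_isWorldOfRecord₃_b16_main_only_exfalso :
    ∃ w : WorldP, IsWorldOfRecord₃ w ∧ ∀ P : B12.RunParams, Dag.B16_main (leavesP w P) →
      ¬ ((w.up P).b5 ∧ (w.up P).b6 ∧ (w.up P).b7 ∧ (w.up P).b9 ∧ (w.up P).b10 ∧ (w.up P).b11 ∧ (w.up P).b13 ∧
          (w.up P).rBasicStep ∧ ((w.C P).flow.InInterval w.γ P.K → ∀ k, k ≤ P.K → (w.C P).IndAss k)) := by
  obtain ⟨w, hw, hnot⟩ := exists_isWorldOfRecord₃_not_conclusion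
  refine ⟨w, hw, fun P h hante => hnot P ?_⟩
  obtain ⟨h5, h6, h7, h9, h10, h11, h13, h15, hsf⟩ := hante
  exact h h5 h6 h7 h9 h10 h11 h13 h15 hsf

/-- **Conversely the two product slots are jointly satisfiable at a Stage-3 world of record, where N13 then HOLDS at every run by §2**
(DEGENERATE witness: `S := True` for the 𝐑-carriers; a one-configuration construction with `ρ ≡ 1`, `χ ≡ 1`, `A ≡ 0`, `g ≡ 1`, one site,
`e± ≡ 0`, for which (2.50) reads `1 ≤ 1 ≤ 1`).  With `exists_isWorldOfRecord₃_not_conclusion`: N13 is INDEPENDENT of `Node00.IsWorldOfRecord₃`.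
[cite: Balaban1989LargeFieldII, Thm 1 and (0.1) p.355 (bookkeeping: the node is decided only by the Stage-5 objects)] -/
theorem exists_isWorldOfRecord₃_b16_main :
    ∃ w : WorldP, IsWorldOfRecord₃ w ∧ (∀ P : B12.RunParams, (leavesP w P).rOperation) ∧
      ∀ P : B12.RunParams, Dag.B16_main (leavesP w P) := by
  obtain ⟨V, hV⟩ := exists_rOpLeaf
  obtain ⟨θ, hθ, -⟩ := exists_stage3Params_admissible
  obtain ⟨X⟩ := nonempty_printedCarriersR; obtain ⟨Y⟩ := nonempty_printedCarriers9X
  obtain ⟨Z⟩ := nonempty_printedCarriers11; obtain ⟨W⟩ := nonempty_printedCarriers15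
  let w : WorldP :=
    { C := fun _ =>
        { flow := { g := fun _ => 1, β := fun _ _ => 0 }, Cfg := fun _ => PUnit, dom := fun _ => Set.univ, effAction := fun _ _ => 0,
          wilsonBG := fun _ _ => 0, Ek := fun _ _ => 0, numSites := fun _ => 1, Repr := fun _ => True, IndAss := fun _ => True,
          ρ := fun _ _ => 1, χ := fun _ _ => 1, Sect2Form := fun _ => True },
      γ := 1, em := fun _ => 0, ep := fun _ => 0, βup := 1, β₀ := 1, β₀_pos := one_pos, b := 1, b_pos := one_pos, L := 2,
      one_lt_L := one_lt_two, gR := 1,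
      up := fun _ => Upstream.ofPrintedAllXPN (carriers₃ θ X) Y Z V W }
  have hw : IsWorldOfRecord₃ w := isWorldOfRecord₃_of_up θ hθ X Y Z V W w rfl
  have hR : ∀ P : B12.RunParams, (leavesP w P).rOperation := fun P =>
    (rOperation_iff_rOpLeaf (w := w) (P := P) rfl).2 hV
  have huv : ∀ P : B12.RunParams, (leavesP w P).uvBounds := by
    intro P k _ U
    show (1 : ℝ) * Real.exp (-(1 / (1 : ℝ) ^ 2 * 0) - 0 * ((1 : ℕ) : ℝ)) ≤ 1 ∧ (1 : ℝ) ≤ Real.exp (0 * ((1 : ℕ) : ℝ))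
    norm_num
  exact ⟨w, hw, hR, fun P _ _ _ _ _ _ _ _ _ => ⟨hR P, fun _ _ => huv P⟩⟩

/-- **The hypotheses of the knit of record (`b16_main_of_pinnedR_of_cor3Leaves`) are JOINTLY SATISFIABLE at a Stage-3 world of record**
(DEGENERATE witness: the world of `exists_isWorldOfRecord₃_b16_main` with the ONE-TERM representation `Adm := Unit`, summand `ρ_k ≡ 1`,
majorant `1`): the knit does not quantify over an empty class, and none of its seven displayed hypotheses contradicts the others.
[cite: Balaban1988Convergent, (2.18) p.257, Cor. 3 (2.50) p.264 (bookkeeping: satisfiability of the typed leaves)] -/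
theorem exists_isWorldOfRecord₃_knitHypotheses :
    ∃ (w : WorldP) (V₀ : B12.RunParams → PrintedCarriers14R) (R : B14Cor3.ReprFamily w.C), IsWorldOfRecord₃ w ∧
      (∀ P : B12.RunParams, ∃ (X : PrintedCarriersR) (Y : PrintedCarriers9X) (Z : PrintedCarriers11) (W : PrintedCarriers15),
        w.up P = Upstream.ofPrintedAllXPN X Y Z (V₀ P) W) ∧
      (∀ P : B12.RunParams, ROpLeaf (V₀ P)) ∧
      B14Cor3.LeafH w.C R w.γ ∧ B14Cor3.LeafU1 w.C R w.γ ∧ B14Cor3.LeafU2 w.C R w.γ w.ep ∧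
      B14Cor3.LeafL1 w.C R w.γ ∧ B14Cor3.LeafL2 w.C R w.γ w.em := by
  obtain ⟨V, hV⟩ := exists_rOpLeaf
  obtain ⟨θ, hθ, -⟩ := exists_stage3Params_admissible
  obtain ⟨X⟩ := nonempty_printedCarriersR; obtain ⟨Y⟩ := nonempty_printedCarriers9X
  obtain ⟨Z⟩ := nonempty_printedCarriers11; obtain ⟨W⟩ := nonempty_printedCarriers15
  let w : WorldP :=
    { C := fun _ =>
        { flow := { g := fun _ => 1, β := fun _ _ => 0 }, Cfg := fun _ => PUnit, dom := fun _ => Set.univ, effAction := fun _ _ => 0,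
          wilsonBG := fun _ _ => 0, Ek := fun _ _ => 0, numSites := fun _ => 1, Repr := fun _ => True, IndAss := fun _ => True,
          ρ := fun _ _ => 1, χ := fun _ _ => 1, Sect2Form := fun _ => True },
      γ := 1, em := fun _ => 0, ep := fun _ => 0, βup := 1, β₀ := 1, β₀_pos := one_pos, b := 1, b_pos := one_pos, L := 2,
      one_lt_L := one_lt_two, gR := 1,
      up := fun _ => Upstream.ofPrintedAllXPN (carriers₃ θ X) Y Z V W }
  let R : B14Cor3.ReprFamily w.C := fun _ _ => { Adm := Unit, term := fun _ _ => 1, major := fun _ => 1, allSmall := () }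
  refine ⟨w, fun _ => V, R, isWorldOfRecord₃_of_up θ hθ X Y Z V W w rfl, fun _ => ⟨carriers₃ θ X, Y, Z, W, rfl⟩, fun _ => hV,
    ?_, ?_, ?_, ?_, ?_⟩
  · intro P _ k _ _ U
    show (1 : ℝ) = ∑ _a : Unit, (1 : ℝ)
    simp
  · intro P _ k _ _ a U
    show (1 : ℝ) ≤ 1
    exact le_rfl
  · intro P _ k _ _
    show ∑ _a : Unit, (1 : ℝ) ≤ Real.exp (0 * ((1 : ℕ) : ℝ))
    simp
  · intro P _ k _ _ a U
    show (0 : ℝ) ≤ 1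
    exact zero_le_one
  · intro P _ k _ _ U
    show (1 : ℝ) * Real.exp (-(1 / (1 : ℝ) ^ 2 * 0) - 0 * ((1 : ℕ) : ℝ)) ≤ 1
    norm_num

end Literature.MathematicalPhysics.QuantumFieldTheory.Balaban1983to89.B16NodeKnit
end
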